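import Summits.QuantumFields.YangMills.Theses.GronwallGap
import Literature.MathematicalPhysics.QuantumLattice.PlaquetteWeightFreeEnergyLimit

/-!
# Crux `AnalyticDetour` (stmt-QuantumFields-8801), line `registered`:
# the stub `stub_torusPressureLimit` (thermodynamic limit of the torus pressure for a general
# continuous positive plaquette weight)

Registered stub of the skeleton `Cruxes/AnalyticDetour/Lines/registered.lean` (route
`GronwallGap`, sub-problem `YangMills`), proved verbatim: for a compact second-countable Hausdorff
group `G` with a Borel σ-algebra and a continuous single-plaquette weight `v : G → ℝ` with
`0 < v`, the torus pressure `(L+1)⁻⁴ log ∫ ∏_q v(U_q) d(⊗_e Haar)(U)` of the pure plaquette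
lattice gauge theory on `(ℤ/(L+1)ℤ)^4` converges as `L → ∞` along *all* torus sides.  In the line
this supplies the real-axis limits for the Vitali argument of `stub_nearHaarAnalytic` (weights
`v · e^{tφ}` far from the Haar point, where no expansion is available).

Proof: the `d = 4` case of the Literature theorem
`Literature.MathematicalPhysics.QuantumLattice.tendsto_torusPressure_of_continuous_pos`
(`Literature/MathematicalPhysics/QuantumLattice/PlaquetteWeightFreeEnergyLimit.lean`, with the box
decomposition in `PlaquetteWeightFreeEnergy.lean`): the van Hove / Friedli–Velenik Thm. 3.6
argument of the tree's `LatticeGaugeDLRFreeEnergyProofs` (Wilson weight) ported to a general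
continuous positive weight, which enters only through the compactness bound `e^{-K} ≤ v ≤ e^{K}`
(translation invariance and factorisation of the infinite product Haar measure over edge-disjoint
boxes of plaquettes, periodisation `integral_torusLift_eq_integral_zdHaar`, the sub-box estimate
`|log Z_L − q^d log Z(A_m)| ≤ K · #planes · (L^d − q^d (m−1)^d)`, and a Cauchy argument).
The Hausdorff hypothesis of the registered signature is not used.

No named facts are used; no definitions are introduced.
-/

namespace Summit.QuantumFields.YangMills.Theorems

/-- **Stub `stub_torusPressureLimit` — thermodynamic limit of the torus pressure for a general
continuous positive plaquette weight.** For a compact metrisable group `G` (Borel σ-algebra) and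
`v : G → ℝ` continuous and positive, `(L+1)⁻⁴ log ∫ ∏_{q} v(U_q) d(⊗ Haar)` converges as `L → ∞`
along all torus sides `L+1` (Friedli–Velenik 2017 Thm. 3.6; the `d = 4` case of
`Literature.MathematicalPhysics.QuantumLattice.tendsto_torusPressure_of_continuous_pos`, the
general-weight port of the tree's `LatticeGaugeDLRFreeEnergyProofs`). -/
theorem stub_torusPressureLimit :
    ∀ (G : Type) [Group G] [TopologicalSpace G] [IsTopologicalGroup G] [CompactSpace G] [T2Space G] [SecondCountableTopology G] [MeasurableSpace G] [BorelSpace G], ∀ v : G → ℝ, Continuous v → (∀ g : G, 0 < v g) → ∃ P : ℝ, Filter.Tendsto (fun L : ℕ => (((L + 1 : ℕ) : ℝ) ^ 4)⁻¹ * Real.log (∫ U : Literature.MathematicalPhysics.QuantumFieldTheory.GaugeConfig 4 (L + 1) G, ∏ q : Literature.MathematicalPhysics.QuantumFieldTheory.Plaquette 4 (L + 1), v (Literature.MathematicalPhysics.QuantumFieldTheory.plaquetteHolonomy U q.1 q.2.1.1 q.2.1.2) ∂(MeasureTheory.Measure.pi fun _ : Literature.MathematicalPhysics.QuantumFieldTheory.Edge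 4 (L + 1) => Literature.MathematicalPhysics.QuantumFieldTheory.haarProbability G))) Filter.atTop (nhds P) := by
  intro G _ _ _ _ _ _ _ _ v hv hpos
  exact Literature.MathematicalPhysics.QuantumLattice.tendsto_torusPressure_of_continuous_pos
    (d := 4) hv hpos

end Summit.QuantumFields.YangMills.Theorems
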